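import Literature.IUT.HodgeTheaters.PiAvatarLabelAffine
import HarnessLib

/-!
# Kit laws `gLab_range` (both halves) and `autCsp_le` at the genuine `𝒟^{⊚±}`: the slope of the cusp action `actF n` IS
# d065's exponent `conjExponent n` on the rank one quotient `Π_{X_K}/Π_{X̲_K}` ([IUTchI] Def 6.1 (v); proof-only — steps 3–4 of
# the abc-iut-L5-t4 next-seat plan, over abc-iut-L5-t3's `PiAvatarLabelAffine`; post-freeze additive D13, not a cone member)

S. Mochizuki, *Inter-universal Teichmüller theory I*, kurims manuscript (May 2020), Def 6.1 (v) p. 158 («this rank one quotient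
determines a natural surjective homomorphism `Aut(𝒟^{⊚±}) ↠ 𝔽_l^⋇` … whose kernel we denote by `Aut_±(𝒟^{⊚±})`»; «`Aut_csp(𝒟^{⊚±})
⊆ Aut_±(𝒟^{⊚±})` … the subgroup of automorphisms that fix the cusps of `X_K`»; «natural outer isomorphisms `Aut_K(X_K) ⥲
Aut_±(𝒟^{⊚±})/Aut_csp(𝒟^{⊚±}) ⥲ 𝔽_l^{⋊±}`»), Prop 6.5 (iv) p. 165 («the natural bijection `Aut_±(†𝒟^{⊚±})/Aut_csp(†𝒟^{⊚±}) ⥲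
Aut_±(LabCusp^±(†𝒟^{⊚±}))`») ([IUTchI] Def 6.1 (v) p.158) [claim: Mochizuki2012, status: disputed] (D-0012 claim key, series
status DISPUTED — kernel theorems over abc-iut-L5-t2's REAL `InitialThetaData`, abc-iut-L5-t1's `CuspGalois`, under the binder
`hS : D.CuspClassesNormaliserStable` of G-L5t4g3-3 and the instance binder `[(D.PiXund.subgroupOf D.PiXK).Normal]` (supplied
at the instance by abc-iut-L5-t8's `TorsionMonodromy.normal_PiXund_subgroupOf_PiXK`, p433603); nothing of the series is asserted,
no side is taken on [IUTchIII] Cor. 3.12).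

## What is proved (for `D : InitialThetaData`, `CG : D.geom.pe.CuspGalois`, `hS`, `[Fact l.Prime]`; `n ∈ N_{Π_{C_F}}(Π_{X̲_K})`)
* `gChart₀Model_act_pow_of_mem_PiX` — `g ∈ Π_X` iterated: `gChart₀ (gᵏ·x) = gChart₀ x + k · gChart₀ (g·ε⁰)`;
* **`gChart₀Model_act_ε0_of_embK_eq_conj`** — conjugation by `n` multiplies translation amounts by the exponent: for `g ∈ Π_X` and
  `embK g′ = n·embK g·n⁻¹`, `gChart₀ (g′·ε⁰) = conjExponent(n) · gChart₀ (g·ε⁰)` (d065's `conjExponent_spec` read on the cusps);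
* **`actFSlope_eq_conjExponent`** / `actFSlopeHom_eq_conjExponent` — STEP 3: t3's slope `actFSlope n` (linear part of the affine
  map `actF n`, `gChart₀Model_actF`) equals `(conjExponent n : 𝔽_l)` — print's «rank one quotient» read two ways;
* `toFlStarOnNormalizer_eq_one_iff_actFSlope` — `toFlStar = 1 ↔ slope = ±1`; `actF_mem_autPM_iff` — `actF n ∈ Aut_±(LabCusp^±) ↔
  slope = ±1`;
* STEP 4, the kit laws at the genuine `𝒟^{⊚±}`: **`gLabAutModel_mem_autPM_iff`** (`gLabMap α ∈ Aut_±(LabCusp^±(𝒟^{⊚±})) ↔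
  toFlStar α = 1`, i.e. `Aut_± = gLabMap⁻¹(Aut_±(torsor))`), **`gLab_range_model`** (kit law `gLab_range`, both halves — with t4's
  `exists_aut_of_mem_autPM`), **`toFlStarGlobal_eq_one_of_gLabAutModel_eq_one`** (kit law `autCsp_le` at the model: fixing the
  cusps forces exponent `1`).
No def, no instance, no notation; typed ≠ proved elsewhere.
-/

noncomputable section

namespace Literature.IUT.HodgeTheaters

open CategoryTheory

universe u v w

section LabelAutPM

variable {F : Type u} {K : Type v} {Fbar : Type w} [Field F] [NumberField F] [Field K] [NumberField K]
  [Algebra F K] [Field Fbar] [Algebra F Fbar] [Algebra K Fbar]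
  {E : WeierstrassCurve F} [E.IsElliptic] {l : ℕ} {Pb : BadPlacePredicates K}
  (D : InitialThetaData F K Fbar E l Pb) (CG : D.geom.pe.CuspGalois) (hS : D.CuspClassesNormaliserStable)

namespace InitialThetaData

variable [Fact l.Prime]

/-! ### Powers of translations; the exponent acts on translation amounts -/

/-- `g ∈ Π_X` iterated `k` times translates by `k · gChart₀ (g·ε⁰)` in the chart based at `ε⁰`.
([IUTchI] Def 6.1 (v) p.158) [claim: Mochizuki2012, status: disputed] -/
theorem gChart₀Model_act_pow_of_mem_PiX {g : D.geom.pe.PiC} (hg : g ∈ D.geom.pe.PiX) (k : ℕ) (x : D.geom.pe.Cusp) :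
    D.gChart₀Model CG ((CG.act g ^ k) x) =
      D.gChart₀Model CG x + (k : ZMod l) * D.gChart₀Model CG (CG.act g D.geom.pe.ε0) := by
  induction k with
  | zero => simp
  | succ k ih =>
    rw [pow_succ', Equiv.Perm.mul_apply, D.gChart₀Model_act_of_mem_PiX CG hg, ih, Nat.cast_succ]
    ring

/-- **Conjugation by `n ∈ N(Π_{X̲_K})` multiplies translation amounts by d065's exponent**: for `g ∈ Π_X` and `g′` with
`embK g′ = n·embK g·n⁻¹` (so `g′ ∈ Π_X`), `gChart₀ (g′·ε⁰) = conjExponent(n) · gChart₀ (g·ε⁰)` — `conjExponent_spec` says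
`(gᵘ)⁻¹ g′ ∈ Π_X̲` acts trivially on the cusps. ([IUTchI] Def 6.1 (v) p.158) [claim: Mochizuki2012, status: disputed] -/
theorem gChart₀Model_act_ε0_of_embK_eq_conj [(D.PiXund.subgroupOf D.PiXK).Normal]
    (n : ↥(Subgroup.normalizer ((D.PiXund : Subgroup D.PiC) : Set D.PiC)))
    {g g' : D.geom.pe.PiC} (hg : g ∈ D.geom.pe.PiX) (hg' : D.geom.embK g' = (n : D.PiC) * D.geom.embK g * (n : D.PiC)⁻¹) :
    D.gChart₀Model CG (CG.act g' D.geom.pe.ε0) =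
      ((conjExponent D.PiXund D.PiXK D.PiXund_le_PiXK D.PiXund_relIndex_PiXK (D.normalizerIncl n) : (ZMod l)ˣ) : ZMod l) *
        D.gChart₀Model CG (CG.act g D.geom.pe.ε0) := by
  set u : (ZMod l)ˣ := conjExponent D.PiXund D.PiXK D.PiXund_le_PiXK D.PiXund_relIndex_PiXK (D.normalizerIncl n) with hu
  have hgK : D.geom.embK g ∈ D.PiXK := by
    rw [PiXK_eq_map]
    exact Subgroup.mem_map_of_mem _ hg
  -- `(embK g ^ u)⁻¹ · (n · embK g · n⁻¹) ∈ Π_{X̲_K}`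
  have hspec := conjExponent_spec D.PiXund_le_PiXK D.PiXund_relIndex_PiXK (D.normalizerIncl n) (D.geom.embK g) hgK
  rw [← hu, coe_normalizerIncl, ← hg', ← map_pow, ← map_inv, ← map_mul] at hspec
  -- pull back along the injective `embK`: `(g ^ u)⁻¹ · g′ ∈ Π_X̲`
  obtain ⟨y, hy, hye⟩ := Subgroup.mem_map.mp hspec
  have hmem : (g ^ (u : ZMod l).val)⁻¹ * g' ∈ D.geom.pe.PiXbar := by
    rwa [← D.geom.embK_injective hye]
  -- hence `act g′ = act (g ^ u)`
  have hact : CG.act g' = CG.act g ^ (u : ZMod l).val := by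
    have h1 := CG.act_eq_one_of_mem_PiXbar hmem
    rw [map_mul, map_inv, inv_mul_eq_one, map_pow] at h1
    exact h1.symm
  rw [hact, D.gChart₀Model_act_pow_of_mem_PiX CG hg, D.gChart₀Model_ε0 CG, zero_add, ZMod.natCast_zmod_val]

/-! ### STEP 3: the slope of `actF n` is the exponent of `n` -/

/-- **STEP 3 — `actFSlope n = conjExponent n` in `𝔽_l`**: the linear part of the affine cusp action of `n` (t3's
`gChart₀Model_actF`) is the exponent by which `n` acts on the rank one quotient `Π_{X_K}/Π_{X̲_K}` (d065's `conjExponent`): both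
are read off the conjugate of the generator `gen` (`ε⁰ ↦ ε′`), via t4's equivariance `actF_act`.
([IUTchI] Def 6.1 (v) p.158) [claim: Mochizuki2012, status: disputed] -/
theorem actFSlope_eq_conjExponent [(D.PiXund.subgroupOf D.PiXK).Normal]
    (n : ↥(Subgroup.normalizer ((D.PiXund : Subgroup D.PiC) : Set D.PiC))) :
    D.actFSlope CG hS n =
      ((conjExponent D.PiXund D.PiXK D.PiXund_le_PiXK D.PiXund_relIndex_PiXK (D.normalizerIncl n) : (ZMod l)ˣ) : ZMod l) := by
  obtain ⟨g', hg'⟩ := D.exists_embK_eq_conj n CG.gen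
  have hg'X : g' ∈ D.geom.pe.PiX := D.mem_PiX_of_embK_eq_conj n CG.gen_mem hg'
  -- `n·ε′ = n·(gen·ε⁰) = g′·(n·ε⁰)`, a translate of `n·ε⁰` by `gChart₀ (g′·ε⁰)`
  have h1 : D.actF CG hS n D.geom.pe.ε1 = CG.act g' (D.actF CG hS n D.geom.pe.ε0) := by
    rw [← CG.act_gen_ε0]
    exact D.actF_act CG hS n CG.gen g' hg' D.geom.pe.ε0
  rw [actFSlope, h1, D.gChart₀Model_act_of_mem_PiX CG hg'X, add_sub_cancel_left,
    D.gChart₀Model_act_ε0_of_embK_eq_conj CG n CG.gen_mem hg', CG.act_gen_ε0, D.gChart₀Model_ε1 CG, mul_one]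

/-- STEP 3, units form: t3's slope character `actFSlopeHom` IS d065's exponent character `conjExponent` (restricted along
`N(Π_{X̲_K}) ↪ N(Π_{X_K}) ∩ N(Π_{X̲_K})`). ([IUTchI] Def 6.1 (v) p.158) [claim: Mochizuki2012, status: disputed] -/
theorem actFSlopeHom_eq_conjExponent [(D.PiXund.subgroupOf D.PiXK).Normal]
    (n : ↥(Subgroup.normalizer ((D.PiXund : Subgroup D.PiC) : Set D.PiC))) :
    D.actFSlopeHom CG hS n =
      conjExponent D.PiXund D.PiXK D.PiXund_le_PiXK D.PiXund_relIndex_PiXK (D.normalizerIncl n) :=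
  Units.ext (by rw [actFSlopeHom_apply, val_actFSlopeUnit, D.actFSlope_eq_conjExponent CG hS n])

/-- d065's character on `N(Π_{X̲_K})` is the class of the slope: `toFlStarOnNormalizer n = [actFSlopeHom n] ∈ 𝔽_l^⋇`.
([IUTchI] Def 6.1 (v) p.158) [claim: Mochizuki2012, status: disputed] -/
theorem toFlStarOnNormalizer_eq_mk_actFSlopeHom [(D.PiXund.subgroupOf D.PiXK).Normal]
    (n : ↥(Subgroup.normalizer ((D.PiXund : Subgroup D.PiC) : Set D.PiC))) :
    D.toFlStarOnNormalizer n = FlStar.mk l (D.actFSlopeHom CG hS n) := by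
  rw [D.actFSlopeHom_eq_conjExponent CG hS n]
  rfl

/-- **`toFlStar n = 1 ↔ slope n = ±1`** (the `Aut_±` shape, d065's `toFlStarOfNormalizer_eq_one_iff`, read on the cusps).
([IUTchI] Def 6.1 (v) p.158) [claim: Mochizuki2012, status: disputed] -/
theorem toFlStarOnNormalizer_eq_one_iff_actFSlope [(D.PiXund.subgroupOf D.PiXK).Normal]
    (n : ↥(Subgroup.normalizer ((D.PiXund : Subgroup D.PiC) : Set D.PiC))) :
    D.toFlStarOnNormalizer n = 1 ↔ D.actFSlope CG hS n = 1 ∨ D.actFSlope CG hS n = -1 := by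
  rw [D.toFlStarOnNormalizer_eq_mk_actFSlopeHom CG hS n, FlStar.mk_eq_one_iff_val, actFSlopeHom_apply, val_actFSlopeUnit]

/-! ### `actF n ∈ Aut_±(LabCusp^±)` iff its slope is `±1` -/

/-- The sign `ε ∈ {±1} ⊆ ℤ^×` acting on `𝔽_l` is multiplication by `±1`. [folklore] -/
private theorem units_smul_eq_mul (ε : ℤˣ) (z : ZMod l) :
    ε • z = (if ε = 1 then (1 : ZMod l) else -1) * z := by
  rcases Int.units_eq_one_or ε with rfl | rfl
  · rw [one_smul, if_pos rfl, one_mul]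
  · rw [Units.neg_smul, one_smul, if_neg (by decide), neg_one_mul]

/-- **`actF n ∈ Aut_±(LabCusp^±(𝒟^{⊚±})) ↔ actFSlope n = ±1`**: an affine map `z ↦ d z + b` of `𝔽_l` lies in `𝔽_l^{⋊±}` iff
`d = ±1`. ([IUTchI] Def 6.1 (v) p.158) [claim: Mochizuki2012, status: disputed] -/
theorem actF_mem_autPM_iff (n : ↥(Subgroup.normalizer ((D.PiXund : Subgroup D.PiC) : Set D.PiC))) :
    D.actF CG hS n ∈ (D.gLabTModel CG).autPM ↔ D.actFSlope CG hS n = 1 ∨ D.actFSlope CG hS n = -1 := by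
  constructor
  · intro h
    obtain ⟨g, hg⟩ := (FlPMTorsor.mem_autPM_iff _ _).mp h _ (D.gChart₀Model_mem_charts CG)
    -- compare the two readings at `ε⁰` (`↦ 0`) and `ε′` (`↦ 1`)
    have h0 := hg D.geom.pe.ε0
    have h1 := hg D.geom.pe.ε1
    rw [D.gChart₀Model_actF CG hS n, FlPM.smul_def] at h0 h1
    rw [D.gChart₀Model_ε0 CG, mul_zero, zero_add, smul_zero, zero_add] at h0
    rw [D.gChart₀Model_ε1 CG, mul_one, h0, add_left_inj] at h1
    rw [h1]
    rcases Int.units_eq_one_or g.right with hε | hε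
    · left
      rw [hε, one_smul]
    · right
      rw [hε, Units.neg_smul, one_smul]
  · intro h
    rw [FlPMTorsor.mem_autPM_iff_exists]
    refine ⟨D.gChart₀Model CG, D.gChart₀Model_mem_charts CG, ?_⟩
    rcases h with h | h
    · refine ⟨FlPM.mk (D.gChart₀Model CG (D.actF CG hS n D.geom.pe.ε0)) 1, fun t => ?_⟩
      rw [D.gChart₀Model_actF CG hS n, h, FlPM.mk_smul, one_smul, one_mul]
    · refine ⟨FlPM.mk (D.gChart₀Model CG (D.actF CG hS n D.geom.pe.ε0)) (-1), fun t => ?_⟩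
      rw [D.gChart₀Model_actF CG hS n, h, FlPM.mk_smul, Units.neg_smul, one_smul, neg_one_mul]

/-- `actF n ∈ Aut_±(LabCusp^±) ↔ toFlStar n = 1` (on normaliser representatives). ([IUTchI] Def 6.1 (v) p.158) [claim: Mochizuki2012, status: disputed] -/
theorem actF_mem_autPM_iff_toFlStarOnNormalizer [(D.PiXund.subgroupOf D.PiXK).Normal]
    (n : ↥(Subgroup.normalizer ((D.PiXund : Subgroup D.PiC) : Set D.PiC))) :
    D.actF CG hS n ∈ (D.gLabTModel CG).autPM ↔ D.toFlStarOnNormalizer n = 1 := by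
  rw [D.actF_mem_autPM_iff CG hS n, D.toFlStarOnNormalizer_eq_one_iff_actFSlope CG hS n]

/-! ### STEP 4: the kit laws at `𝒟^{⊚±}` -/

variable [(D.PiXund.subgroupOf D.PiXK).Normal]

/-- **`Aut_±(𝒟^{⊚±}) = gLabMap⁻¹(Aut_±(LabCusp^±(𝒟^{⊚±})))`**: for every automorphism `α` of `𝒟^{⊚±}`, its label action lies in
`Aut_±` of the torsor iff `toFlStar α = 1` ([IUTchI] Def 6.1 (v): «`Aut_±(𝒟^{⊚±})/Aut_csp ⥲ 𝔽_l^{⋊±}`»; Prop 6.5 (iv)).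
([IUTchI] Def 6.1 (v) p.158) [claim: Mochizuki2012, status: disputed] -/
theorem gLabAutModel_mem_autPM_iff (α : Aut (D.gModelObj)) :
    D.gLabAutModel CG hS α ∈ (D.gLabTModel CG).autPM ↔ D.toFlStarGlobal α = 1 := by
  obtain ⟨m, hm, rfl⟩ := OrbitCat.exists_eq_autOfNormalizer α
  rw [D.gLabAutModel_autOfNormalizer CG hS m hm, D.toFlStarGlobal_autOfNormalizer m hm, inv_eq_one, Subgroup.inv_mem_iff,
    D.actF_mem_autPM_iff_toFlStarOnNormalizer CG hS]

/-- **Kit law `gLab_range`, `←` half**: automorphisms in `Aut_±(𝒟^{⊚±})` (`toFlStar α = 1`) act on `LabCusp^±(𝒟^{⊚±})` through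
`Aut_±` of its `𝔽_l^±`-torsor structure. ([IUTchI] Def 6.1 (v) p.158) [claim: Mochizuki2012, status: disputed] -/
theorem gLabAutModel_mem_autPM_of_toFlStarGlobal_eq_one {α : Aut (D.gModelObj)} (hα : D.toFlStarGlobal α = 1) :
    D.gLabAutModel CG hS α ∈ (D.gLabTModel CG).autPM :=
  (D.gLabAutModel_mem_autPM_iff CG hS α).mpr hα

/-- **Kit law `gLab_range` at the genuine `𝒟^{⊚±}` (both halves)**: the image of `Aut_±(𝒟^{⊚±})` in the permutations of
`LabCusp^±(𝒟^{⊚±})` is exactly `Aut_±` of the torsor («`Aut_±(𝒟^{⊚±})/Aut_csp(𝒟^{⊚±}) ⥲ Aut_±(LabCusp^±(𝒟^{⊚±}))`», Prop 6.5 (iv);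
`→` = t4's `exists_aut_of_mem_autPM`, `←` = STEP 4). ([IUTchI] Def 6.1 (v) p.158) [claim: Mochizuki2012, status: disputed] -/
theorem gLab_range_model (σ : Equiv.Perm D.geom.pe.Cusp) :
    σ ∈ (D.gLabTModel CG).autPM ↔ ∃ α : Aut (D.gModelObj), D.toFlStarGlobal α = 1 ∧ D.gLabAutModel CG hS α = σ := by
  constructor
  · exact D.exists_aut_of_mem_autPM CG hS
  · rintro ⟨α, hα, rfl⟩
    exact D.gLabAutModel_mem_autPM_of_toFlStarGlobal_eq_one CG hS hα

/-- **Kit law `autCsp_le` at the genuine `𝒟^{⊚±}`**: an automorphism fixing all the cusps (`gLabMap α = 1`, i.e. `α ∈ Aut_csp`)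
has `toFlStar α = 1` (it acts with exponent `1` on the rank one quotient: «`Aut_csp(𝒟^{⊚±}) ⊆ Aut_±(𝒟^{⊚±})`»).
([IUTchI] Def 6.1 (v) p.158) [claim: Mochizuki2012, status: disputed] -/
theorem toFlStarGlobal_eq_one_of_gLabAutModel_eq_one {α : Aut (D.gModelObj)} (hα : D.gLabAutModel CG hS α = 1) :
    D.toFlStarGlobal α = 1 := by
  rw [← D.gLabAutModel_mem_autPM_iff CG hS α, hα]
  exact one_mem _

/-- `autCsp_le` in the kit's literal shape (`gLabMap α = Equiv.refl`). ([IUTchI] Def 6.1 (v) p.158) [claim: Mochizuki2012, status: disputed] -/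
theorem autCsp_le_model (α : Aut (D.gModelObj)) (hα : D.gLabAutModel CG hS α = Equiv.refl _) :
    D.toFlStarGlobal α = 1 :=
  D.toFlStarGlobal_eq_one_of_gLabAutModel_eq_one CG hS hα

/-- Sharper: an automorphism fixing the cusps acts with exponent EXACTLY `1` (not merely `±1`) on `Π_{X_K}/Π_{X̲_K}` — its slope is
`1` (`ε′ ↦ ε′`). ([IUTchI] Def 6.1 (v) p.158) [claim: Mochizuki2012, status: disputed] -/
theorem conjExponent_eq_one_of_actF_eq_one (n : ↥(Subgroup.normalizer ((D.PiXund : Subgroup D.PiC) : Set D.PiC)))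
    (hn : D.actF CG hS n = 1) :
    conjExponent D.PiXund D.PiXK D.PiXund_le_PiXK D.PiXund_relIndex_PiXK (D.normalizerIncl n) = 1 := by
  rw [← D.actFSlopeHom_eq_conjExponent CG hS n]
  apply Units.ext
  rw [actFSlopeHom_apply, val_actFSlopeUnit, Units.val_one, actFSlope, hn, Equiv.Perm.one_apply, Equiv.Perm.one_apply,
    D.gChart₀Model_ε1 CG, D.gChart₀Model_ε0 CG, sub_zero]

end InitialThetaData

end LabelAutPM

end Literature.IUT.HodgeTheaters
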